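import Mathlib
import HarnessLib
import Summits.HubbardSuperconductivity.HubbardSuperconductivity.Theorems.KLProgrammeKLRegimeVolumeLimitLastScaleUnits
import Summits.HubbardSuperconductivity.HubbardSuperconductivity.Theorems.KLProgrammeKLRegimeTwoVolumeDualReadoutRows
import Summits.HubbardSuperconductivity.HubbardSuperconductivity.Theorems.KLProgrammeKLRegimeTwoVolumeDualMomentumReadout
import Summits.HubbardSuperconductivity.HubbardSuperconductivity.Theses.KLProgramme

/-!
# Route `KLProgramme` — crux K3, VL child `KLRegimeVolumeLimitV17F2` (stmt-HubbardSuperconductivity-20440): THE REGISTERED STUB TEXT FROM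
# WEIGHTED (DRESSED) DUAL ROWS AT THE COMMON FRAME — the end door of the source-shift organisation (R-src) of located risk #8 «(VL)-DEAD-LEG ≡
# VL-OBSERVABLE-SECTOR»
# (cell gate-hubbard-kl, seat hubbard-kl-k3c5-p3 g10, technique «OS-positivity-free direct assembly»; plan (R59t)/(R59u)/(R59aa))

Under (R-src) the (A3) chain ends, at `n⋆ = nScales β + 1`, with DRESSED objects: Grassmann elements `G_V` (e.g. `T_V(K_L) ∘ (φ ↦ C_V φ)`, k3c4-p1's
`D_V^{(n⋆)}`) whose self-energy string at a label is the reading `Σ^{K_L}_V(ω,k)` times a WEIGHT `w(ω,p_k)` (the dressing `C(ω,p)²`) — the same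
weight in both volumes at a common lattice momentum, bounded away from `0` at a fixed Matsubara integer (`|C|⁻¹ ≤ |ω| + 4 + |μ| + ‖K_L‖_∞`).  This file
turns the two-volume pinned defect of the position-space rows of ANY such pair `(G_L, G_{L″})` into the registered stub text — the dual read-out
(p551583) is linear, so the weight divides out:

* §1 (generic, ns `TwoVolumeDefect`) `rows_baseIndependent_of_diagonal` (k3c5-p2's `row_eq_of_diagonal`), **`norm_sub_le_of_weightedDualDefect`**
  (`‖X_c − X_f‖ ≤ ‖w‖⁻¹·2ε·(Ddef₊ + Dfar₊)` whenever `Σ_{G_c}(ω,k) = w·X_c`, `Σ_{G_f}(ω,k″) = w·X_f`, `p_{k″} = p_k`, diagonal `(+,−)` two-leg kernels),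
  `norm_le_of_weightedDualRows` (`‖X_c‖ ≤ ‖w‖⁻¹·2ε·Σ_y‖R_c(o;y)‖`);
* §2 **`framedNestedFlowTextV17F2_of_commonFrameWeightedDualRows`** — stub text ⟸ «per Matsubara integer `∃ L₀ δ→0 B w₀>0`: for `L ≥ L₀`, `L″ = b·L`, eventually
  in `M`, `∃ G_c G_f w o_c o_f`: diagonal two-leg kernels; at every label of integer `n`: `w₀ ≤ ‖w k‖`, `Σ_{G_c}(ω,k) = w k·Σ^{K_L}_L(ω,k)`,
  `Σ_{G_f}(ω,k″) = w k·Σ^{K_L}_{L″}(ω,k″)` at `p_{k″} = p_k`, `2ε·(Ddef₊ + Dfar₊)(G_c,G_f) ≤ δ L`, `2ε·Σ_y‖R_{G_c}(o_c;y)‖ ≤ B`» — NOTHING ELSE: the unit is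
  k3c4-p2's `isUnit_effPartitionFn_lastScale_eventually`, the own-frame passage k3c4-p2's `framedNestedFlowTextV17F2_of_commonFrame_bounded`;
  `volumeLimitTextV17F2_…` and the by-workitem closer **`KLRegimeVolumeLimitV17F2_of_commonFrameWeightedDualRows`**.

With `G_V := T_V(K_L) − 𝒩_{K_L}` and `w ≡ 1` this is k3c4-p2's `…_of_commonFrameDualRows` up to the frame value; with `G_V :=` the dressed last-scale action it
is the read-out owed by (R-src) (VL-INDUCTION-BLUEPRINT-g9 §B last bullet).  Proofs only; no definition.  References: BGM 2006 §2.4 (2.38), §2.9 (4.10a)–(4.15).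
-/

noncomputable section

/-! ## §1 Weighted dual read-out (generic in the elements) -/

namespace Summit.HubbardSuperconductivity.HubbardSuperconductivity.Theorems.TwoVolumeDefect

set_option linter.dupNamespace false -- summit = problem name (single-conjunct summit), D-0017

open Finset Complex Literature.MathematicalPhysics.QuantumLattice Literature.Probability.LatticeModels GrassmannAlgebra
open Summit.HubbardSuperconductivity.HubbardSuperconductivity.Theorems.KLProgrammeLegKernels

section Weighted

variable {Lc Lf b M : ℕ} [NeZero Lc] [NeZero Lf] [NeZero M]

omit [NeZero Lf] [NeZero M] in
/-- **Base-point independence of the phase-weighted rows of ANY element with diagonal `(+,−)` two-leg momentum kernel** (k3c5-p2's row formula).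
[cite: BenfattoGiulianiMastropietro2006, §2.1 (2.5)] -/
theorem rows_baseIndependent_of_diagonal {β : ℝ} (hβ : β ≠ 0) (G : HubbardGrassmann Lc M) (m : MatsubaraIdx M) (σ : Fin 2)
    (hdiag : ∀ k k' : FreqMomentum Lc M, k' ≠ k → kernel ℂ G 2 ![((k, σ), 0), ((k', σ), 1)] = 0)
    (x₀ x₀' : SpaceTimeIdx Lc M) (z : TorusSite 2 Lc) :
    (∑ t₁ : ImagTimeIdx M,
        sectorisedKernel Lc M β (trivialMultiplier Lc M) G 2 (![((0, σ), 0), ((0, σ), 1)] : Fin 2 → SectorLeg 1) ![x₀, (t₁, x₀.2 + z)] *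
          Complex.exp (((matsubaraFreq β M m * (imagTime β M x₀.1 - imagTime β M t₁) : ℝ) : ℂ) * I)) =
      ∑ t₁ : ImagTimeIdx M,
        sectorisedKernel Lc M β (trivialMultiplier Lc M) G 2 (![((0, σ), 0), ((0, σ), 1)] : Fin 2 → SectorLeg 1) ![x₀', (t₁, x₀'.2 + z)] *
          Complex.exp (((matsubaraFreq β M m * (imagTime β M x₀'.1 - imagTime β M t₁) : ℝ) : ℂ) * I) := by
  rw [row_eq_of_diagonal hβ G m σ hdiag x₀ z, row_eq_of_diagonal hβ G m σ hdiag x₀' z]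

/-- **THE WEIGHTED DUAL READ-OUT AT A COMMON GRID MOMENTUM**: if `Σ_{G_c}((ω,k),σ) = w·X_c` and `Σ_{G_f}((ω,k″),σ) = w·X_f` with `w ≠ 0`, `p_{k″} = p_k`,
and both elements have diagonal `(+,−)` two-leg kernels, then `‖X_c − X_f‖ ≤ ‖w‖⁻¹ · 2ε·(Σ_ȳ ‖R_c(o_c;ȳ) − R_f(o_f;ȳ↑)‖ + Σ_{y ≠ (red y)↑} ‖R_f(o_f;y)‖)`.
[cite: BenfattoGiulianiMastropietro2006, §2.4 (2.38)] -/
theorem norm_sub_le_of_weightedDualDefect (hL : Lf = b * Lc) {β : ℝ} (hβ : 0 < β)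
    (Gc : HubbardGrassmann Lc M) (Gf : HubbardGrassmann Lf M) (n : MatsubaraIdx M) (σ : Fin 2)
    (hdc : ∀ k k' : FreqMomentum Lc M, k' ≠ k → kernel ℂ Gc 2 ![((k, σ), 0), ((k', σ), 1)] = 0)
    (hdf : ∀ k k' : FreqMomentum Lf M, k' ≠ k → kernel ℂ Gf 2 ![((k, σ), 0), ((k', σ), 1)] = 0)
    (oc : SpaceTimeIdx Lc M) (of : SpaceTimeIdx Lf M)
    {k : TorusSite 2 Lc} {k'' : TorusSite 2 Lf} (hk : latticeMomentum Lf k'' = latticeMomentum Lc k)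
    {w Xc Xf : ℂ} (hw : w ≠ 0) (hc : selfEnergy Lc M β Gc (n, k) σ = w * Xc) (hf : selfEnergy Lf M β Gf (n, k'') σ = w * Xf) :
    ‖Xc - Xf‖ ≤ ‖w‖⁻¹ *
      (2 * imagTimeWeight β M *
        ((∑ ybar : TorusSite 2 Lc,
            ‖(∑ t₁ : ImagTimeIdx M,
                sectorisedKernel Lc M β (trivialMultiplier Lc M) Gc 2 (![((0, σ), 0), ((0, σ), 1)] : Fin 2 → SectorLeg 1) ![oc, (t₁, oc.2 + ybar)] *
                  Complex.exp (((matsubaraFreq β M n * (imagTime β M oc.1 - imagTime β M t₁) : ℝ) : ℂ) * I)) -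
              (∑ t₁ : ImagTimeIdx M,
                sectorisedKernel Lf M β (trivialMultiplier Lf M) Gf 2 (![((0, σ), 0), ((0, σ), 1)] : Fin 2 → SectorLeg 1)
                    ![of, (t₁, of.2 + Torus.proj Lf (Torus.cRep ybar))] *
                  Complex.exp (((matsubaraFreq β M n * (imagTime β M of.1 - imagTime β M t₁) : ℝ) : ℂ) * I))‖) +
          ∑ y ∈ univ.filter (fun y : TorusSite 2 Lf => Torus.proj Lf (Torus.cRep (fun i => (((y i).val : ℕ) : ZMod Lc))) ≠ y),
            ‖∑ t₁ : ImagTimeIdx M,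
                sectorisedKernel Lf M β (trivialMultiplier Lf M) Gf 2 (![((0, σ), 0), ((0, σ), 1)] : Fin 2 → SectorLeg 1) ![of, (t₁, of.2 + y)] *
                  Complex.exp (((matsubaraFreq β M n * (imagTime β M of.1 - imagTime β M t₁) : ℝ) : ℂ) * I)‖)) := by
  have h := norm_selfEnergy_sub_le_dualDefect_of_latticeMomentum_eq hL hβ Gc Gf n σ
    (rows_baseIndependent_of_diagonal hβ.ne' Gc n σ hdc) (rows_baseIndependent_of_diagonal hβ.ne' Gf n σ hdf) oc of hk
  rw [hc, hf, ← mul_sub, norm_mul] at h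
  have hw' : 0 < ‖w‖ := norm_pos_iff.2 hw
  calc ‖Xc - Xf‖ = ‖w‖⁻¹ * (‖w‖ * ‖Xc - Xf‖) := by field_simp
    _ ≤ _ := mul_le_mul_of_nonneg_left h (inv_nonneg.2 hw'.le)

omit [NeZero Lf] in
/-- **Weighted one-volume size**: if `Σ_G((ω,k),σ) = w·X` with `w ≠ 0` and `G` has a diagonal two-leg kernel, `‖X‖ ≤ ‖w‖⁻¹·2ε·Σ_y ‖R_G(o;y)‖`.
[cite: BenfattoGiulianiMastropietro2006, §2.1 (2.5)] -/
theorem norm_le_of_weightedDualRows {β : ℝ} (hβ : 0 < β) (G : HubbardGrassmann Lc M) (n : MatsubaraIdx M) (σ : Fin 2)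
    (hdiag : ∀ k k' : FreqMomentum Lc M, k' ≠ k → kernel ℂ G 2 ![((k, σ), 0), ((k', σ), 1)] = 0)
    (o : SpaceTimeIdx Lc M) (k : TorusSite 2 Lc) {w X : ℂ} (hw : w ≠ 0) (hX : selfEnergy Lc M β G (n, k) σ = w * X) :
    ‖X‖ ≤ ‖w‖⁻¹ * (2 * imagTimeWeight β M * ∑ y : TorusSite 2 Lc,
      ‖∑ t₁ : ImagTimeIdx M,
          sectorisedKernel Lc M β (trivialMultiplier Lc M) G 2 (![((0, σ), 0), ((0, σ), 1)] : Fin 2 → SectorLeg 1) ![o, (t₁, o.2 + y)] *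
            Complex.exp (((matsubaraFreq β M n * (imagTime β M o.1 - imagTime β M t₁) : ℝ) : ℂ) * I)‖) := by
  have h := norm_selfEnergy_le_dualRows hβ G n σ (rows_baseIndependent_of_diagonal hβ.ne' G n σ hdiag) o k
  rw [hX, norm_mul] at h
  have hw' : 0 < ‖w‖ := norm_pos_iff.2 hw
  calc ‖X‖ = ‖w‖⁻¹ * (‖w‖ * ‖X‖) := by field_simp
    _ ≤ _ := mul_le_mul_of_nonneg_left h (inv_nonneg.2 hw'.le)

end Weighted

end Summit.HubbardSuperconductivity.HubbardSuperconductivity.Theorems.TwoVolumeDefect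

/-! ## §2 The stub text from weighted dual rows at the common frame -/

namespace Summit.HubbardSuperconductivity.HubbardSuperconductivity.Theorems.TwoPointAssembly

set_option linter.dupNamespace false -- summit = problem name (single-conjunct summit), D-0017

open Finset Filter Topology Complex Literature.MathematicalPhysics.QuantumLattice Literature.Probability.LatticeModels GrassmannAlgebra
open Summit.HubbardSuperconductivity.HubbardSuperconductivity.Theorems.KLRegimeSplit
open Summit.HubbardSuperconductivity.HubbardSuperconductivity.Theorems.KLProgrammeLegKernels
open Summit.HubbardSuperconductivity.HubbardSuperconductivity.Theorems.TwoVolumeDefect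

/-- **THE STUB TEXT OF «cauchy v8-F2» FROM WEIGHTED (DRESSED) DUAL ROWS AT THE COMMON FRAME — NOTHING ELSE.**  See the module docstring for the
hypothesis; the weight `w k` (`‖w k‖ ≥ w₀ > 0`, one `w₀` per Matsubara integer) divides out of the linear read-out; the unit partition function and the
own-frame passage are the tree's. [cite: BenfattoGiulianiMastropietro2006, §2.4 (2.38) and §2.9 (4.15)] -/
theorem framedNestedFlowTextV17F2_of_commonFrameWeightedDualRows
    (hW : ∀ (G : GeoConsts) (P : SplitConsts) (Q : EngConsts) (R : RenConsts), G.WF → P.WF → Q.WF → R.WF →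
      ∃ c₅ : ℝ, 0 < c₅ ∧ ∀ c : ℝ, 0 < c → c ≤ c₅ → ∃ U₀ : ℝ, 0 < U₀ ∧
        ∀ μ ∈ klWindowC, ∀ U : ℝ, 0 < U → U ≤ U₀ → ∀ β : ℝ, klBetaMin ≤ β → β ≤ Real.exp (c / U ^ 2) →
          ∀ K : TrigPolyC4v, klPredsV17F2.frameOK R U (nScales β) μ K →
            ∀ (Lstar : ℕ) (Mstar : ℕ → ℕ), TowerP klPredsV17F2 G P Q R β U μ K Lstar Mstar →
              ∀ n : ℤ, ∃ L₀ : ℕ, ∃ δ : ℕ → ℝ, ∃ B w₀ : ℝ, 0 < w₀ ∧ Tendsto δ atTop (𝓝 0) ∧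
                ∀ (L : ℕ) [NeZero L], L₀ ≤ L → ∀ (L'' : ℕ) [NeZero L''] (b : ℕ), L'' = b * L → ∃ M₀ : ℕ, ∀ (M : ℕ) [NeZero M], M₀ ≤ M →
                  ∃ (Gc : HubbardGrassmann L M) (Gf : HubbardGrassmann L'' M) (w : TorusSite 2 L → ℂ)
                    (oc : SpaceTimeIdx L M) (of : SpaceTimeIdx L'' M),
                    (∀ k k' : FreqMomentum L M, k' ≠ k → kernel ℂ Gc 2 ![((k, 0), 0), ((k', 0), 1)] = 0) ∧
                    (∀ k k' : FreqMomentum L'' M, k' ≠ k → kernel ℂ Gf 2 ![((k, 0), 0), ((k', 0), 1)] = 0) ∧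
                    ∀ ω : MatsubaraIdx M, matsubaraInt M ω = n →
                      (∀ k : TorusSite 2 L, w₀ ≤ ‖w k‖ ∧
                        selfEnergy L M β Gc (ω, k) 0 =
                          w k * klSelfEnergy L M β U μ (klFlowFrameU L M β U μ (nScales β + 1)) klE0 (nScales β + 1) (ω, k) 0) ∧
                      (∀ (k : TorusSite 2 L) (k'' : TorusSite 2 L''), latticeMomentum L'' k'' = latticeMomentum L k →
                        selfEnergy L'' M β Gf (ω, k'') 0 =
                          w k * klSelfEnergy L'' M β U μ (klFlowFrameU L M β U μ (nScales β + 1)) klE0 (nScales β + 1) (ω, k'') 0) ∧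
                      2 * imagTimeWeight β M *
                        ((∑ ybar : TorusSite 2 L,
                            ‖(∑ t₁ : ImagTimeIdx M,
                                sectorisedKernel L M β (trivialMultiplier L M) Gc 2 (![((0, 0), 0), ((0, 0), 1)] : Fin 2 → SectorLeg 1)
                                    ![oc, (t₁, oc.2 + ybar)] *
                                  Complex.exp (((matsubaraFreq β M ω * (imagTime β M oc.1 - imagTime β M t₁) : ℝ) : ℂ) * I)) -
                              (∑ t₁ : ImagTimeIdx M,
                                sectorisedKernel L'' M β (trivialMultiplier L'' M) Gf 2 (![((0, 0), 0), ((0, 0), 1)] : Fin 2 → SectorLeg 1)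
                                    ![of, (t₁, of.2 + Torus.proj L'' (Torus.cRep ybar))] *
                                  Complex.exp (((matsubaraFreq β M ω * (imagTime β M of.1 - imagTime β M t₁) : ℝ) : ℂ) * I))‖) +
                          ∑ y ∈ univ.filter (fun y : TorusSite 2 L'' => Torus.proj L'' (Torus.cRep (fun i => (((y i).val : ℕ) : ZMod L))) ≠ y),
                            ‖∑ t₁ : ImagTimeIdx M,
                                sectorisedKernel L'' M β (trivialMultiplier L'' M) Gf 2 (![((0, 0), 0), ((0, 0), 1)] : Fin 2 → SectorLeg 1)
                                    ![of, (t₁, of.2 + y)] *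
                                  Complex.exp (((matsubaraFreq β M ω * (imagTime β M of.1 - imagTime β M t₁) : ℝ) : ℂ) * I)‖) ≤ δ L ∧
                      2 * imagTimeWeight β M * ∑ y : TorusSite 2 L,
                        ‖∑ t₁ : ImagTimeIdx M,
                            sectorisedKernel L M β (trivialMultiplier L M) Gc 2 (![((0, 0), 0), ((0, 0), 1)] : Fin 2 → SectorLeg 1)
                                ![oc, (t₁, oc.2 + y)] *
                              Complex.exp (((matsubaraFreq β M ω * (imagTime β M oc.1 - imagTime β M t₁) : ℝ) : ℂ) * I)‖ ≤ B) :
    ∀ (G : GeoConsts) (P : SplitConsts) (Q : EngConsts) (R : RenConsts), G.WF → P.WF → Q.WF → R.WF →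
      ∃ c₅ : ℝ, 0 < c₅ ∧ ∀ c : ℝ, 0 < c → c ≤ c₅ → ∃ U₀ : ℝ, 0 < U₀ ∧
        ∀ μ ∈ klWindowC, ∀ U : ℝ, 0 < U → U ≤ U₀ → ∀ β : ℝ, klBetaMin ≤ β → β ≤ Real.exp (c / U ^ 2) →
          ∀ K : TrigPolyC4v, klPredsV17F2.frameOK R U (nScales β) μ K →
            ∀ (Lstar : ℕ) (Mstar : ℕ → ℕ), TowerP klPredsV17F2 G P Q R β U μ K Lstar Mstar →
              ∀ n : ℤ, ∃ L₀ : ℕ, ∃ ρ : ℕ → ℝ, Tendsto ρ atTop (𝓝 0) ∧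
                ∀ (L : ℕ) [NeZero L], L₀ ≤ L → ∀ (L'' : ℕ) [NeZero L''], L ∣ L'' → ∃ M₀ : ℕ, ∀ (M : ℕ) [NeZero M], M₀ ≤ M →
                  ∀ (ω : MatsubaraIdx M), matsubaraInt M ω = n → ∀ (k : TorusSite 2 L) (k'' : TorusSite 2 L''),
                    latticeMomentum L'' k'' = latticeMomentum L k →
                      ‖klSelfEnergy L M β U μ (klFlowFrameU L M β U μ (nScales β + 1)) klE0 (nScales β + 1) (ω, k) 0 -
                          klSelfEnergy L'' M β U μ (klFlowFrameU L'' M β U μ (nScales β + 1)) klE0 (nScales β + 1) (ω, k'') 0‖ ≤ ρ L := by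
  refine framedNestedFlowTextV17F2_of_commonFrame_bounded ?_
  intro G P Q R hG hP hQ hR
  obtain ⟨c₅, hc₅, hc⟩ := hW G P Q R hG hP hQ hR
  refine ⟨c₅, hc₅, fun c hc0 hcc => ?_⟩
  obtain ⟨U₀, hU₀, hU⟩ := hc c hc0 hcc
  refine ⟨U₀, hU₀, fun μ hμ U hU0 hUU β hβmin hβmax K hK Lstar Mstar hT n => ?_⟩
  have hβ : 0 < β := pos_of_klBetaMin_le hβmin
  obtain ⟨L₀, δ, B, w₀, hw₀, hδ, hWn⟩ := hU μ hμ U hU0 hUU β hβmin hβmax K hK Lstar Mstar hT n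
  refine ⟨max L₀ 3, fun L => w₀⁻¹ * δ L, w₀⁻¹ * B, by simpa using hδ.const_mul w₀⁻¹, fun L _ hL L'' _ hdvd => ?_⟩
  obtain ⟨b, hb⟩ := hdvd
  have hb' : L'' = b * L := by rw [hb, mul_comm]
  have hL₀ : L₀ ≤ L := (le_max_left _ _).trans hL
  have hL3 : 3 ≤ L := (le_max_right _ _).trans hL
  have hL'' : 3 ≤ L'' := hL3.trans (Nat.le_of_dvd (Nat.pos_of_ne_zero (NeZero.ne L'')) ⟨b, hb⟩)
  obtain ⟨M₀, hM₀⟩ := hWn L hL₀ L'' b hb'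
  obtain ⟨M₁, hM₁⟩ := isUnit_effPartitionFn_lastScale_eventually (L := L'') hβ U μ hL''
  refine ⟨max M₀ M₁, fun M _ hM ω hω k k'' hk => ?_⟩
  have hMM₀ : M₀ ≤ M := (le_max_left _ _).trans hM
  have hMM₁ : M₁ ≤ M := (le_max_right _ _).trans hM
  obtain ⟨Gc, Gf, w, oc, of, hdc, hdf, hlab⟩ := hM₀ M hMM₀
  obtain ⟨hwc, hwf, hdef, hB⟩ := hlab ω hω
  have hwk : w₀ ≤ ‖w k‖ := (hwc k).1
  have hwk0 : w k ≠ 0 := fun h => by rw [h, norm_zero] at hwk; exact absurd hwk (not_le.2 hw₀)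
  have hinv : ‖w k‖⁻¹ ≤ w₀⁻¹ := by
    rw [inv_le_inv₀ (norm_pos_iff.2 hwk0) hw₀]; exact hwk
  have hε : 0 ≤ 2 * imagTimeWeight β M := by have := imagTimeWeight_nonneg hβ.le M; positivity
  refine ⟨hM₁ M hMM₁ _, ?_, ?_⟩
  · -- leg (i): the weighted dual read-out at the common frame
    have hi := norm_sub_le_of_weightedDualDefect hb' hβ Gc Gf ω 0 hdc hdf oc of hk hwk0 (hwc k).2 (hwf k k'' hk)
    refine hi.trans ?_
    have hdef0 : 0 ≤ δ L := le_trans (mul_nonneg hε (add_nonneg (sum_nonneg fun _ _ => norm_nonneg _)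
      (sum_nonneg fun _ _ => norm_nonneg _))) hdef
    calc _ ≤ ‖w k‖⁻¹ * δ L := mul_le_mul_of_nonneg_left hdef (inv_nonneg.2 (norm_nonneg _))
      _ ≤ w₀⁻¹ * δ L := mul_le_mul_of_nonneg_right hinv hdef0
  · -- the one-volume bound
    have hi := norm_le_of_weightedDualRows hβ Gc ω 0 hdc oc k hwk0 (hwc k).2
    refine hi.trans ?_
    have hB0 : 0 ≤ B := le_trans (mul_nonneg hε (sum_nonneg fun _ _ => norm_nonneg _)) hB
    calc _ ≤ ‖w k‖⁻¹ * B := mul_le_mul_of_nonneg_left hB (inv_nonneg.2 (norm_nonneg _))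
      _ ≤ w₀⁻¹ * B := mul_le_mul_of_nonneg_right hinv hB0

/-- **The VL child text from weighted dual rows at the common frame.** [cite: BenfattoGiulianiMastropietro2006, §2.4 (2.38)] -/
theorem volumeLimitTextV17F2_of_commonFrameWeightedDualRows
    (hW : ∀ (G : GeoConsts) (P : SplitConsts) (Q : EngConsts) (R : RenConsts), G.WF → P.WF → Q.WF → R.WF →
      ∃ c₅ : ℝ, 0 < c₅ ∧ ∀ c : ℝ, 0 < c → c ≤ c₅ → ∃ U₀ : ℝ, 0 < U₀ ∧
        ∀ μ ∈ klWindowC, ∀ U : ℝ, 0 < U → U ≤ U₀ → ∀ β : ℝ, klBetaMin ≤ β → β ≤ Real.exp (c / U ^ 2) →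
          ∀ K : TrigPolyC4v, klPredsV17F2.frameOK R U (nScales β) μ K →
            ∀ (Lstar : ℕ) (Mstar : ℕ → ℕ), TowerP klPredsV17F2 G P Q R β U μ K Lstar Mstar →
              ∀ n : ℤ, ∃ L₀ : ℕ, ∃ δ : ℕ → ℝ, ∃ B w₀ : ℝ, 0 < w₀ ∧ Tendsto δ atTop (𝓝 0) ∧
                ∀ (L : ℕ) [NeZero L], L₀ ≤ L → ∀ (L'' : ℕ) [NeZero L''] (b : ℕ), L'' = b * L → ∃ M₀ : ℕ, ∀ (M : ℕ) [NeZero M], M₀ ≤ M →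
                  ∃ (Gc : HubbardGrassmann L M) (Gf : HubbardGrassmann L'' M) (w : TorusSite 2 L → ℂ)
                    (oc : SpaceTimeIdx L M) (of : SpaceTimeIdx L'' M),
                    (∀ k k' : FreqMomentum L M, k' ≠ k → kernel ℂ Gc 2 ![((k, 0), 0), ((k', 0), 1)] = 0) ∧
                    (∀ k k' : FreqMomentum L'' M, k' ≠ k → kernel ℂ Gf 2 ![((k, 0), 0), ((k', 0), 1)] = 0) ∧
                    ∀ ω : MatsubaraIdx M, matsubaraInt M ω = n →
                      (∀ k : TorusSite 2 L, w₀ ≤ ‖w k‖ ∧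
                        selfEnergy L M β Gc (ω, k) 0 =
                          w k * klSelfEnergy L M β U μ (klFlowFrameU L M β U μ (nScales β + 1)) klE0 (nScales β + 1) (ω, k) 0) ∧
                      (∀ (k : TorusSite 2 L) (k'' : TorusSite 2 L''), latticeMomentum L'' k'' = latticeMomentum L k →
                        selfEnergy L'' M β Gf (ω, k'') 0 =
                          w k * klSelfEnergy L'' M β U μ (klFlowFrameU L M β U μ (nScales β + 1)) klE0 (nScales β + 1) (ω, k'') 0) ∧
                      2 * imagTimeWeight β M *
                        ((∑ ybar : TorusSite 2 L,
                            ‖(∑ t₁ : ImagTimeIdx M,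
                                sectorisedKernel L M β (trivialMultiplier L M) Gc 2 (![((0, 0), 0), ((0, 0), 1)] : Fin 2 → SectorLeg 1)
                                    ![oc, (t₁, oc.2 + ybar)] *
                                  Complex.exp (((matsubaraFreq β M ω * (imagTime β M oc.1 - imagTime β M t₁) : ℝ) : ℂ) * I)) -
                              (∑ t₁ : ImagTimeIdx M,
                                sectorisedKernel L'' M β (trivialMultiplier L'' M) Gf 2 (![((0, 0), 0), ((0, 0), 1)] : Fin 2 → SectorLeg 1)
                                    ![of, (t₁, of.2 + Torus.proj L'' (Torus.cRep ybar))] *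
                                  Complex.exp (((matsubaraFreq β M ω * (imagTime β M of.1 - imagTime β M t₁) : ℝ) : ℂ) * I))‖) +
                          ∑ y ∈ univ.filter (fun y : TorusSite 2 L'' => Torus.proj L'' (Torus.cRep (fun i => (((y i).val : ℕ) : ZMod L))) ≠ y),
                            ‖∑ t₁ : ImagTimeIdx M,
                                sectorisedKernel L'' M β (trivialMultiplier L'' M) Gf 2 (![((0, 0), 0), ((0, 0), 1)] : Fin 2 → SectorLeg 1)
                                    ![of, (t₁, of.2 + y)] *
                                  Complex.exp (((matsubaraFreq β M ω * (imagTime β M of.1 - imagTime β M t₁) : ℝ) : ℂ) * I)‖) ≤ δ L ∧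
                      2 * imagTimeWeight β M * ∑ y : TorusSite 2 L,
                        ‖∑ t₁ : ImagTimeIdx M,
                            sectorisedKernel L M β (trivialMultiplier L M) Gc 2 (![((0, 0), 0), ((0, 0), 1)] : Fin 2 → SectorLeg 1)
                                ![oc, (t₁, oc.2 + y)] *
                              Complex.exp (((matsubaraFreq β M ω * (imagTime β M oc.1 - imagTime β M t₁) : ℝ) : ℂ) * I)‖ ≤ B) :
    VolumeLimitP2 klPredsV17F2 FinalTwoLegVolLimitEx klWindowC :=
  volumeLimitTextV17F2_of_framedNestedFlowText (framedNestedFlowTextV17F2_of_commonFrameWeightedDualRows hW)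

/-- **The rev-22 VL child `KLRegimeVolumeLimitV17F2` (stmt-…-20440) from weighted dual rows at the common frame** (by-`--workitem` closer).
[cite: BenfattoGiulianiMastropietro2006, §2.4 (2.38)] -/
theorem KLRegimeVolumeLimitV17F2_of_commonFrameWeightedDualRows
    (hW : ∀ (G : GeoConsts) (P : SplitConsts) (Q : EngConsts) (R : RenConsts), G.WF → P.WF → Q.WF → R.WF →
      ∃ c₅ : ℝ, 0 < c₅ ∧ ∀ c : ℝ, 0 < c → c ≤ c₅ → ∃ U₀ : ℝ, 0 < U₀ ∧
        ∀ μ ∈ klWindowC, ∀ U : ℝ, 0 < U → U ≤ U₀ → ∀ β : ℝ, klBetaMin ≤ β → β ≤ Real.exp (c / U ^ 2) →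
          ∀ K : TrigPolyC4v, klPredsV17F2.frameOK R U (nScales β) μ K →
            ∀ (Lstar : ℕ) (Mstar : ℕ → ℕ), TowerP klPredsV17F2 G P Q R β U μ K Lstar Mstar →
              ∀ n : ℤ, ∃ L₀ : ℕ, ∃ δ : ℕ → ℝ, ∃ B w₀ : ℝ, 0 < w₀ ∧ Tendsto δ atTop (𝓝 0) ∧
                ∀ (L : ℕ) [NeZero L], L₀ ≤ L → ∀ (L'' : ℕ) [NeZero L''] (b : ℕ), L'' = b * L → ∃ M₀ : ℕ, ∀ (M : ℕ) [NeZero M], M₀ ≤ M →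
                  ∃ (Gc : HubbardGrassmann L M) (Gf : HubbardGrassmann L'' M) (w : TorusSite 2 L → ℂ)
                    (oc : SpaceTimeIdx L M) (of : SpaceTimeIdx L'' M),
                    (∀ k k' : FreqMomentum L M, k' ≠ k → kernel ℂ Gc 2 ![((k, 0), 0), ((k', 0), 1)] = 0) ∧
                    (∀ k k' : FreqMomentum L'' M, k' ≠ k → kernel ℂ Gf 2 ![((k, 0), 0), ((k', 0), 1)] = 0) ∧
                    ∀ ω : MatsubaraIdx M, matsubaraInt M ω = n →
                      (∀ k : TorusSite 2 L, w₀ ≤ ‖w k‖ ∧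
                        selfEnergy L M β Gc (ω, k) 0 =
                          w k * klSelfEnergy L M β U μ (klFlowFrameU L M β U μ (nScales β + 1)) klE0 (nScales β + 1) (ω, k) 0) ∧
                      (∀ (k : TorusSite 2 L) (k'' : TorusSite 2 L''), latticeMomentum L'' k'' = latticeMomentum L k →
                        selfEnergy L'' M β Gf (ω, k'') 0 =
                          w k * klSelfEnergy L'' M β U μ (klFlowFrameU L M β U μ (nScales β + 1)) klE0 (nScales β + 1) (ω, k'') 0) ∧
                      2 * imagTimeWeight β M *
                        ((∑ ybar : TorusSite 2 L,
                            ‖(∑ t₁ : ImagTimeIdx M,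
                                sectorisedKernel L M β (trivialMultiplier L M) Gc 2 (![((0, 0), 0), ((0, 0), 1)] : Fin 2 → SectorLeg 1)
                                    ![oc, (t₁, oc.2 + ybar)] *
                                  Complex.exp (((matsubaraFreq β M ω * (imagTime β M oc.1 - imagTime β M t₁) : ℝ) : ℂ) * I)) -
                              (∑ t₁ : ImagTimeIdx M,
                                sectorisedKernel L'' M β (trivialMultiplier L'' M) Gf 2 (![((0, 0), 0), ((0, 0), 1)] : Fin 2 → SectorLeg 1)
                                    ![of, (t₁, of.2 + Torus.proj L'' (Torus.cRep ybar))] *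
                                  Complex.exp (((matsubaraFreq β M ω * (imagTime β M of.1 - imagTime β M t₁) : ℝ) : ℂ) * I))‖) +
                          ∑ y ∈ univ.filter (fun y : TorusSite 2 L'' => Torus.proj L'' (Torus.cRep (fun i => (((y i).val : ℕ) : ZMod L))) ≠ y),
                            ‖∑ t₁ : ImagTimeIdx M,
                                sectorisedKernel L'' M β (trivialMultiplier L'' M) Gf 2 (![((0, 0), 0), ((0, 0), 1)] : Fin 2 → SectorLeg 1)
                                    ![of, (t₁, of.2 + y)] *
                                  Complex.exp (((matsubaraFreq β M ω * (imagTime β M of.1 - imagTime β M t₁) : ℝ) : ℂ) * I)‖) ≤ δ L ∧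
                      2 * imagTimeWeight β M * ∑ y : TorusSite 2 L,
                        ‖∑ t₁ : ImagTimeIdx M,
                            sectorisedKernel L M β (trivialMultiplier L M) Gc 2 (![((0, 0), 0), ((0, 0), 1)] : Fin 2 → SectorLeg 1)
                                ![oc, (t₁, oc.2 + y)] *
                              Complex.exp (((matsubaraFreq β M ω * (imagTime β M oc.1 - imagTime β M t₁) : ℝ) : ℂ) * I)‖ ≤ B) :
    Summit.HubbardSuperconductivity.HubbardSuperconductivity.Theses.KLProgramme.KLRegimeVolumeLimitV17F2 :=
  volumeLimitTextV17F2_of_commonFrameWeightedDualRows hW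

end Summit.HubbardSuperconductivity.HubbardSuperconductivity.Theorems.TwoPointAssembly
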